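import Summits.QuantumFields.YangMills.Theorems.BalabanUVNodesN20AtRecord11
import Summits.QuantumFields.YangMills.Theorems.BalabanUVNodesN21AtRecord11
import Literature.MathematicalPhysics.QuantumFieldTheory.Balaban1983to89.Node00.RateRecord11
import Literature.MathematicalPhysics.QuantumFieldTheory.Balaban1983to89.Node00.Record11DatumKey

/-!
# THE SPINE-CARRIER PREDICATE OF RECORD AT NODE 00's STAGE 11 — `YMDAG.UVSplit.SRec₁₁ cr : SpineRecordPred N`, KEYED FUNCTIONALLY to the
# admissible Stage-11 parameter tuples with provisos of `Node00.IsRecordOfRecord₁₁C` (`Node00/Record11.lean`, p444286), and the ONE-APPLICATION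
# instances of the five K5 stubs `S_N27x` · `S_N20` · `S_N21` · `S_N19` · `S_U4` of the cut (`BalabanUVNodesClustersCore`, p416552) at it

Track A of `YM-PLAN.md` (cell `pub-ymgap`, HUMAN RULING D-0062); the (T-SPINE) file of the RATE-RECORD HOME at ₁₁ in dag-lead's DIVISION WORDS-99
(pub-ymgap INBOX l.≈12195, 2026-08-26): «(N) `Node00/<RateRecordObjects11>.lean` = node00-def-RR-1 (objects of record) · (T-RATE)
`BalabanUVNodesRateCarriersOfRecord11.lean` = dag-n22-e (`RRec₁₁`) · (T-SPINE) THIS FILE = dag-n20-e (`SRec₁₁` by the FUNCTIONAL key + the one-application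
instances)»; shape = node00-def-RR-2's PRE-READ §B (70d0fbef117d0737) on the spine side, PINS ONLY (R422: definition first, content stays in the node
stubs).  Definition lane (one `abbrev`, one `def`); every theorem is kernel bookkeeping over tree declarations BY NAME; 0 `sorry`, standard axioms.
COUNT-NEUTRAL; `--supports` the K3 item `SpineGivenEndpointR11` (stmt-QuantumFields-19676).  Restate-immune (no Theses import).

THE DEFINITION.  A READING of spine carriers off NODE 00's Stage-11 tuples is a function
`cr : (F : T4Family) → (θ : Node00.Stage11Params F N) → θ.Provisos₁₁ → (ℕ → ℝ) → List (ULoop F) → SpineCarriers` (`SpineReading₁₁ N`); the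
predicate it KEYS is
`SRec₁₁ cr F D g₀ os S :↔ ∃ θ hP, θ.Admissible ∧ D = Node00.datumOfRecord₁₁ F N θ hP ∧ S = cr F θ hP g₀ os`
— at the datum `D`, the tuned bare sequence `g₀` and the loop string `os`, exactly the bundles the reading assigns to the ADMISSIBLE tuples WITH PROVISOS whose
datum of record IS `D` (the datum clause of `Node00.IsRecordOfRecord₁₁C`; worlds play no role on the spine).  The reading is a PARAMETER of this file
(WORDS-99: «keep the parametric binder until (N) names one; re-key by `rfl` then»): NO reading of Bałaban's (1.72)∕(2.18) DRESSED two-run history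
expansion off the record exists today — what the record pins is the (2.18) expansion of the UNDRESSED densities (`Node00.rhoOfRecord9 = densityOfRepr …`
over `Node00.SeqOfRecord`), and the one missing object is the start-generic dressed slot recursion + node U5d's truncation key (dag-n20-e LOCATED (F1)–(F4),
INBOX l.≈12300).  `sRec₁₁_congr` is the re-key tool: two readings that agree on admissible tuples with provisos key the same predicate.

WHAT THIS MODULE PROVES (all [bookkeeping]).
* §1 FACES: `sRec₁₁_iff` (`Iff.rfl`) · `sRec₁₁_self` (the reading's bundle IS pinned at its own datum) · `exists_stage11_of_sRec₁₁` (typed over ₁₁C) ·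
  `sRec₁₁_image_iff` (a bundle is pinned somewhere iff it is the reading of an admissible tuple with provisos) · `exists_sRec₁₁_of_isRecordOfRecord₁₁C`
  (at every Stage-11 record pair some admissible θ with provisos realises `D` and its reading is pinned for every `(g₀, os)`) · `sRec₁₁_congr` ·
  `exists_pinned_sRec₁₁_of_inhabited` ∕ `sRec₁₁_empty_of_uninhabited` (the K0 link: under the body of `Record11Inhabited` at `N` the predicate pins a
  bundle on every family; if no admissible tuple has provisos it pins nothing).
* §2 THE ONE-APPLICATION INSTANCES: `s_N20_sRec₁₁_iff` (p450743 `N20AtRecord11.s_N20_keyed₁₁_iff` at key `Iff.rfl`) · `s_N21_sRec₁₁_iff` (dag-n21-d's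
  `N21AtRecord11.s_N21_keyed₁₁_iff` at key `Iff.rfl`) ·
  `s_N19_sRec₁₁_iff` (K4's hook `Inputs` read at `datumOfRecord₁₁ F N θ hP`) · `s_U4_sRec₁₁_iff` — the four ANTITONE stubs become «for every family,
  every admissible Stage-11 θ with provisos, every `g₀`, `os`: the node's estimate at `cr F θ hP g₀ os`» — and `s_N27x_sRec₁₁_of` (the MONOTONE
  extraction stub at `Rec := Node00.IsRecordOfRecord₁₁C F N`: SUFFICIENT θ-form — `0 < l₀`, `0 < vol`, E1∕E2 against the dressed partition functions
  `schemeZ ((datumOfRecord₁₁ F N θ hP).scheme g₀) os (K₀ + K) t` ∕ `(K₀ + K + 1)` at every admissible θ; θ is NOT determined by `D`, so no iff is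
  claimed) · `s_N20_sRec₁₁_of_extractionLaws` (N20's closer at `SRec₁₁ cr`: p450743 §2 BY NAME).  These are binder for binder the K5 hypotheses of
  n27-c's `BalabanUVNodesN27.spineGivenEndpointR11_of_K5stubs` (XXI :211) at `SRec := SRec₁₁ cr`.
* §3 HONESTY: `k5_sRec₁₁_of_uninhabited` — if NO admissible Stage-11 tuple satisfies its provisos on any family (the negation of K0's body at `N`), the four
  antitone stubs hold at `SRec₁₁ cr` WITH NO ESTIMATE (located vacuity: the ₁₁ knit is worth exactly K0); `S_N27x` is the existence side and is NOT free.

HONEST FRAMING.  PINS ONLY; nothing of Bałaban's is asserted or instantiated; NE7 ∕ NE7b ∕ NE7c are NOT PRINTED for d = 4 and NOT PROVED; no inhabitant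
of `IsRecordOfRecord₁₁C` is claimed (K0 open); N19 ∕ N20 ∕ N21 ∕ N27 are NOT discharged (0∕1 at every record); typed 28∕28, discharged count untouched;
one finite four-torus programme at fixed `ε` — NOT ℝ⁴, NOT infinite volume, NOT OS, NOT a mass gap, NOT Clay.  No decl below carries a cite tag.
-/

open Finset

namespace YMDAG.UVSplit

open Literature.MathematicalPhysics.QuantumFieldTheory.Balaban1983to89
open Literature.MathematicalPhysics.QuantumFieldTheory.Balaban1983to89.T4Continuum
open T4WeightBudget (RelWeightBound)
open T4IndicatorShell (ShellWeightBound)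
open Summit.QuantumFields.BalabanUV.T4Continuum.Spine
open Summit.QuantumFields.BalabanUV.T4Continuum.NE7b.PinnedExtraction (ExtractionLaws)
open Summit.QuantumFields.YangMills.Theorems.N20AtRecord11 (s_N20_keyed₁₁_iff s_N20_keyed₁₁_of_extractionLaws exists_pinned_keyed₁₁_of_inhabited)
open Summit.QuantumFields.YangMills.Theorems.N21AtRecord11 (s_N21_keyed₁₁_iff)
open Summit.QuantumFields.YangMills.Theorems.N20AtSpineCarriers (s_N20_of_empty)
open Node00 (Stage11Params datumOfRecord₁₁ IsRecordOfRecord₁₁C)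

/-! ## §0 The reading type and the definition -/

/-- **A READING OF SPINE CARRIERS OFF NODE 00's STAGE-11 TUPLES**: for every four-torus family, every Stage-11 parameter tuple `θ` with its displayed provisos,
every bare sequence `g₀` and loop string `os`, ONE term-class carrier bundle (`SpineCarriers` of the cut: index type, radius, volume letter, offset, classes,
two runs' weights, shells, bad classes, slots, remainder).  The TYPE only; a reading is a parameter `cr` below ((N) of the home is to supply one). -/
abbrev SpineReading₁₁ (N : ℕ) [NeZero N] : Type 1 :=
  (F : T4Family) → (θ : Stage11Params F N) → θ.Provisos₁₁ → (ℕ → ℝ) → List (ULoop F) → SpineCarriers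

variable {N : ℕ} [NeZero N]

/-- **THE SPINE-CARRIER PREDICATE OF RECORD, STAGE 11, KEYED BY THE READING `cr`** (PINS ONLY): at `(F, D, g₀, os)` it pins exactly the bundles
`cr F θ hP g₀ os` of the ADMISSIBLE Stage-11 tuples `θ` WITH PROVISOS `hP` whose datum of record IS `D` (`D = Node00.datumOfRecord₁₁ F N θ hP`, the datum
clause of `Node00.IsRecordOfRecord₁₁C`). -/
def SRec₁₁ (cr : SpineReading₁₁ N) : SpineRecordPred N :=
  fun F D g₀ os S => ∃ (θ : Stage11Params F N) (hP : θ.Provisos₁₁), θ.Admissible ∧ D = datumOfRecord₁₁ F N θ hP ∧ S = cr F θ hP g₀ os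

variable (cr : SpineReading₁₁ N)

/-! ## §1 Faces -/

/-- Unfolding (`Iff.rfl`). [bookkeeping] -/
theorem sRec₁₁_iff {F : T4Family} (D : Datum F N) (g₀ : ℕ → ℝ) (os : List (ULoop F)) (S : SpineCarriers) :
    SRec₁₁ cr F D g₀ os S ↔
      ∃ (θ : Stage11Params F N) (hP : θ.Provisos₁₁), θ.Admissible ∧ D = datumOfRecord₁₁ F N θ hP ∧ S = cr F θ hP g₀ os :=
  Iff.rfl

/-- **THE READING's BUNDLE IS PINNED AT ITS OWN DATUM**: for an admissible θ with provisos, `SRec₁₁ cr` pins `cr F θ hP g₀ os` at `datumOfRecord₁₁ F N θ hP`.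
[bookkeeping] -/
theorem sRec₁₁_self {F : T4Family} (θ : Stage11Params F N) (hP : θ.Provisos₁₁) (hθ : θ.Admissible) (g₀ : ℕ → ℝ) (os : List (ULoop F)) :
    SRec₁₁ cr F (datumOfRecord₁₁ F N θ hP) g₀ os (cr F θ hP g₀ os) :=
  ⟨θ, hP, hθ, rfl, rfl⟩

/-- **TYPED OVER ₁₁C**: every pinned bundle comes with an admissible Stage-11 tuple with provisos realising the datum, of which it is the reading. [bookkeeping] -/
theorem exists_stage11_of_sRec₁₁ {F : T4Family} {D : Datum F N} {g₀ : ℕ → ℝ} {os : List (ULoop F)} {S : SpineCarriers}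
    (h : SRec₁₁ cr F D g₀ os S) :
    ∃ (θ : Stage11Params F N) (hP : θ.Provisos₁₁), θ.Admissible ∧ D = datumOfRecord₁₁ F N θ hP ∧ S = cr F θ hP g₀ os :=
  h

/-- **THE IMAGE**: a bundle is pinned SOMEWHERE by `SRec₁₁ cr` iff it is the reading of some admissible Stage-11 tuple with provisos at some `(g₀, os)` —
the set the antitone stubs quantify over (p450743 `s_N20_iff_forall_pinned`). [bookkeeping] -/
theorem sRec₁₁_image_iff (S : SpineCarriers) :
    (∃ (F : T4Family) (D : Datum F N) (g₀ : ℕ → ℝ) (os : List (ULoop F)), SRec₁₁ cr F D g₀ os S) ↔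
      ∃ (F : T4Family) (θ : Stage11Params F N) (hP : θ.Provisos₁₁), θ.Admissible ∧ ∃ (g₀ : ℕ → ℝ) (os : List (ULoop F)), S = cr F θ hP g₀ os := by
  constructor
  · rintro ⟨F, D, g₀, os, θ, hP, hθ, -, hS⟩
    exact ⟨F, θ, hP, hθ, g₀, os, hS⟩
  · rintro ⟨F, θ, hP, hθ, g₀, os, hS⟩
    exact ⟨F, datumOfRecord₁₁ F N θ hP, g₀, os, θ, hP, hθ, rfl, hS⟩

/-- **AT A STAGE-11 RECORD PAIR** `(D, w)`: some admissible θ with provisos realises `D` (`Node00.exists_provisos_of_isRecordOfRecord₁₁C`) and, for every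
`(g₀, os)`, its reading IS PINNED AT `D` — the witness shape the monotone stub `S_N27x` asks (§2 `s_N27x_sRec₁₁_of`). [bookkeeping] -/
theorem exists_sRec₁₁_of_isRecordOfRecord₁₁C {F : T4Family} {D : Datum F N} {w : DagBinding.WorldP} (hR : IsRecordOfRecord₁₁C F N D w) :
    ∃ (θ : Stage11Params F N) (hP : θ.Provisos₁₁), θ.Admissible ∧ D = datumOfRecord₁₁ F N θ hP ∧
      ∀ (g₀ : ℕ → ℝ) (os : List (ULoop F)), SRec₁₁ cr F D g₀ os (cr F θ hP g₀ os) := by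
  obtain ⟨θ, hP, hθ, hD⟩ := Node00.exists_provisos_of_isRecordOfRecord₁₁C hR
  exact ⟨θ, hP, hθ, hD, fun g₀ os => ⟨θ, hP, hθ, hD, rfl⟩⟩

/-- **THE RE-KEY TOOL**: two readings that AGREE on the admissible tuples with provisos key the same predicate (so when (N) names its reading, a consumer's
parametric `cr` is re-keyed by one pointwise equation; values off the admissible tuples are junk nobody reads). [bookkeeping] -/
theorem sRec₁₁_congr {cr cr' : SpineReading₁₁ N}
    (h : ∀ (F : T4Family) (θ : Stage11Params F N) (hP : θ.Provisos₁₁), θ.Admissible → ∀ (g₀ : ℕ → ℝ) (os : List (ULoop F)),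
      cr F θ hP g₀ os = cr' F θ hP g₀ os)
    {F : T4Family} (D : Datum F N) (g₀ : ℕ → ℝ) (os : List (ULoop F)) (S : SpineCarriers) :
    SRec₁₁ cr F D g₀ os S ↔ SRec₁₁ cr' F D g₀ os S := by
  constructor
  · rintro ⟨θ, hP, hθ, hD, hS⟩
    exact ⟨θ, hP, hθ, hD, hS.trans (h F θ hP hθ g₀ os)⟩
  · rintro ⟨θ, hP, hθ, hD, hS⟩
    exact ⟨θ, hP, hθ, hD, hS.trans (h F θ hP hθ g₀ os).symm⟩

/-- **K0 LINK, positive side**: under the body of the route's K0 `Record11Inhabited` at `N` (`∀ F, ∃ D w, IsRecordOfRecord₁₁C F N D w` — an antecedent, neither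
proved nor assumed elsewhere) the predicate pins, on every family and for every `(g₀, os)`, a bundle at a Stage-11 datum of record (p450743
`exists_pinned_keyed₁₁_of_inhabited` at key `Iff.rfl`). [bookkeeping] -/
theorem exists_pinned_sRec₁₁_of_inhabited (hK0 : ∀ F : T4Family, ∃ (D : Datum F N) (w : DagBinding.WorldP), IsRecordOfRecord₁₁C F N D w)
    (F : T4Family) (g₀ : ℕ → ℝ) (os : List (ULoop F)) :
    ∃ (D : Datum F N) (w : DagBinding.WorldP) (S : SpineCarriers), IsRecordOfRecord₁₁C F N D w ∧ SRec₁₁ cr F D g₀ os S :=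
  exists_pinned_keyed₁₁_of_inhabited cr (SRec₁₁ cr) (fun _ _ _ _ _ => Iff.rfl) hK0 F g₀ os

/-- **K0 LINK, negative side**: if no admissible Stage-11 tuple satisfies its provisos on any family, `SRec₁₁ cr` pins NOTHING. [bookkeeping] -/
theorem sRec₁₁_empty_of_uninhabited (hempty : ∀ (F : T4Family) (θ : Stage11Params F N), θ.Admissible → ¬ θ.Provisos₁₁)
    (F : T4Family) (D : Datum F N) (g₀ : ℕ → ℝ) (os : List (ULoop F)) (S : SpineCarriers) : ¬ SRec₁₁ cr F D g₀ os S := by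
  rintro ⟨θ, hP, hθ, -, -⟩
  exact hempty F θ hθ hP

/-! ## §2 The one-application instances of the five K5 stubs at `SRec₁₁ cr` -/

/-- **N20 (NE7b) AT THE RECORD**: `S_N20 (SRec₁₁ cr)` ⟺ «for every family, every admissible Stage-11 θ with provisos, every `g₀`, `os`:
`T4WeightBudget.RelWeightBound` at `cr F θ hP g₀ os`» — p450743 `N20AtRecord11.s_N20_keyed₁₁_iff` at key `Iff.rfl`. [bookkeeping] -/
theorem s_N20_sRec₁₁_iff :
    S_N20 (SRec₁₁ cr) ↔ ∀ (F : T4Family) (θ : Stage11Params F N) (hP : θ.Provisos₁₁), θ.Admissible → ∀ (g₀ : ℕ → ℝ) (os : List (ULoop F)),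
      RelWeightBound (cr F θ hP g₀ os).l₀ (cr F θ hP g₀ os).T (cr F θ hP g₀ os).A (cr F θ hP g₀ os).B (cr F θ hP g₀ os).Bad
        (cr F θ hP g₀ os).W :=
  s_N20_keyed₁₁_iff cr (SRec₁₁ cr) fun _ _ _ _ _ => Iff.rfl

/-- **N21 (NE7c) AT THE RECORD**: `S_N21 (SRec₁₁ cr)` ⟺ «for every admissible Stage-11 θ with provisos, every `g₀`, `os`:
`T4IndicatorShell.ShellWeightBound` at `cr F θ hP g₀ os`» — dag-n21-d's `N21AtRecord11.s_N21_keyed₁₁_iff` at key `Iff.rfl` (its `…N21AtRecord11` §2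
closers `s_N21_keyed₁₁_of_slotLedgers ∕ _of_levels ∕ _of_ages` plug in by name at `SRec := SRec₁₁ cr`, `hkey := fun _ _ _ _ _ h => h`). [bookkeeping] -/
theorem s_N21_sRec₁₁_iff :
    S_N21 (SRec₁₁ cr) ↔ ∀ (F : T4Family) (θ : Stage11Params F N) (hP : θ.Provisos₁₁), θ.Admissible → ∀ (g₀ : ℕ → ℝ) (os : List (ULoop F)),
      ShellWeightBound (cr F θ hP g₀ os).l₀ (cr F θ hP g₀ os).T (cr F θ hP g₀ os).A (cr F θ hP g₀ os).B (cr F θ hP g₀ os).shA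
        (cr F θ hP g₀ os).shB (cr F θ hP g₀ os).Wsh :=
  s_N21_keyed₁₁_iff cr (SRec₁₁ cr) fun _ _ _ _ _ => Iff.rfl

/-- **N19 (NE7 proper, the edge «in-edges ⇒ Core») AT THE RECORD**: `S_N19 (SRec₁₁ cr) Inputs` ⟺ «for every admissible Stage-11 θ with provisos, every
`g₀`, `os`: K4's conclusion `Inputs` READ AT THE DATUM `datumOfRecord₁₁ F N θ hP` gives `Spine.NE7.Core` on the shell-free cores of `cr F θ hP g₀ os`».
(A consumer keying spine AND rate carriers takes THE SAME θ in this face and in (T-RATE)'s — θ is not determined by `D`.) [bookkeeping] -/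
theorem s_N19_sRec₁₁_iff (Inputs : InputsPred N) :
    S_N19 (SRec₁₁ cr) Inputs ↔ ∀ (F : T4Family) (θ : Stage11Params F N) (hP : θ.Provisos₁₁), θ.Admissible →
      ∀ (g₀ : ℕ → ℝ) (os : List (ULoop F)), Inputs F (datumOfRecord₁₁ F N θ hP) g₀ os → letI := (cr F θ hP g₀ os).dec
        NE7.Core (cr F θ hP g₀ os).l₀ (cr F θ hP g₀ os).vol (cr F θ hP g₀ os).T (cr F θ hP g₀ os).Bad
          (fun K t τ => (cr F θ hP g₀ os).A K t τ - (cr F θ hP g₀ os).shA K t τ)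
          (fun K t τ => (cr F θ hP g₀ os).B K t τ - (cr F θ hP g₀ os).shB K t τ) (cr F θ hP g₀ os).δ := by
  constructor
  · intro h F θ hP hθ g₀ os hI
    exact h F (datumOfRecord₁₁ F N θ hP) g₀ os _ (sRec₁₁_self cr θ hP hθ g₀ os) hI
  · rintro h F D g₀ os S ⟨θ, hP, hθ, rfl, rfl⟩ hI
    exact h F θ hP hθ g₀ os hI

/-- **U4′ (budget bookkeeping) AT THE RECORD**: `S_U4 (SRec₁₁ cr)` ⟺ «for every admissible Stage-11 θ with provisos, every `g₀`, `os`: `W + Wsh < 1` and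
`Summable δ` at `cr F θ hP g₀ os`» (still a binder of `SpineMatching_of`; n27-a's tail device makes the budget clause a theorem of the join). [bookkeeping] -/
theorem s_U4_sRec₁₁_iff :
    S_U4 (SRec₁₁ cr) ↔ ∀ (F : T4Family) (θ : Stage11Params F N) (hP : θ.Provisos₁₁), θ.Admissible → ∀ (g₀ : ℕ → ℝ) (os : List (ULoop F)),
      (∀ K, (cr F θ hP g₀ os).W K + (cr F θ hP g₀ os).Wsh K < 1) ∧ Summable (cr F θ hP g₀ os).δ := by
  constructor
  · intro h F θ hP hθ g₀ os
    exact h F (datumOfRecord₁₁ F N θ hP) g₀ os _ (sRec₁₁_self cr θ hP hθ g₀ os)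
  · rintro h F D g₀ os S ⟨θ, hP, hθ, -, rfl⟩
    exact h F θ hP hθ g₀ os

/-- **N27x (the extraction stub, MONOTONE) AT THE RECORD — SUFFICIENT θ-FORM.**  If for every admissible Stage-11 θ with provisos and every `(g₀, os)` the
reading `S := cr F θ hP g₀ os` has `0 < S.l₀`, `0 < S.vol` and satisfies the dictionary E1∕E2 AT THE STAGE-11 DATUM — its class sums ARE the dressed partition
functions `schemeZ ((datumOfRecord₁₁ F N θ hP).scheme g₀) os (S.K₀ + K) t` ∕ `(S.K₀ + K + 1)` on `|t| ≤ S.l₀` (so the expansion is non-degenerate: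
p450743 `schemeZ_pos_datumOfRecord₁₁`) — then `S_N27x (Node00.IsRecordOfRecord₁₁C F N) (SRec₁₁ cr)`: at a record pair pick the θ the pair certifies
(`exists_sRec₁₁_of_isRecordOfRecord₁₁C`) and its reading, under the trivial small-coupling prefix (`ForSmallCouplings.of_forall`).  θ is NOT determined by
`D`, hence no iff. [bookkeeping] -/
theorem s_N27x_sRec₁₁_of
    (h : ∀ (F : T4Family) (θ : Stage11Params F N) (hP : θ.Provisos₁₁), θ.Admissible → ∀ (g₀ : ℕ → ℝ) (os : List (ULoop F)),
      0 < (cr F θ hP g₀ os).l₀ ∧ 0 < (cr F θ hP g₀ os).vol ∧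
        (∀ (K : ℕ) (t : ℝ), |t| ≤ (cr F θ hP g₀ os).l₀ →
          T4GenFunBounds.schemeZ ((datumOfRecord₁₁ F N θ hP).scheme g₀) os ((cr F θ hP g₀ os).K₀ + K) t =
            ∑ τ ∈ (cr F θ hP g₀ os).T K, (cr F θ hP g₀ os).A K t τ) ∧
        (∀ (K : ℕ) (t : ℝ), |t| ≤ (cr F θ hP g₀ os).l₀ →
          T4GenFunBounds.schemeZ ((datumOfRecord₁₁ F N θ hP).scheme g₀) os ((cr F θ hP g₀ os).K₀ + K + 1) t =
            ∑ τ ∈ (cr F θ hP g₀ os).T K, (cr F θ hP g₀ os).B K t τ)) :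
    S_N27x (fun F D w => IsRecordOfRecord₁₁C F N D w) (SRec₁₁ cr) := by
  intro F D w hR _ _
  obtain ⟨θ, hP, hθ, hD, hpin⟩ := exists_sRec₁₁_of_isRecordOfRecord₁₁C cr hR
  subst hD
  refine T4ContinuumYM4Torus.ForSmallCouplings.of_forall fun g₀ os => ?_
  obtain ⟨hl, hv, hE1, hE2⟩ := h F θ hP hθ g₀ os
  exact ⟨cr F θ hP g₀ os, hpin g₀ os, hl, hv, hE1, hE2⟩

/-- **N20's ONE-APPLICATION CLOSER AT `SRec₁₁ cr`** (p450743 `s_N20_keyed₁₁_of_extractionLaws` BY NAME): if at every admissible Stage-11 θ with provisos the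
reading carries the two runs' `PinnedExtraction.ExtractionLaws` at its exact carriers, nonnegative weights, quotient totals `≤ W K` in both runs, `W K < 1`
and `Summable W`, then `S_N20 (SRec₁₁ cr)`. [bookkeeping] -/
theorem s_N20_sRec₁₁_of_extractionLaws
    (hrows : ∀ (F : T4Family) (θ : Stage11Params F N) (hP : θ.Provisos₁₁), θ.Admissible → ∀ (g₀ : ℕ → ℝ) (os : List (ULoop F)),
      ∃ (α α' : Type) (X : ℕ → Finset α) (Badx : ℕ → α → Finset (cr F θ hP g₀ os).ι) (q : ℕ → α → ℝ)
        (X' : ℕ → Finset α') (Badx' : ℕ → α' → Finset (cr F θ hP g₀ os).ι) (q' : ℕ → α' → ℝ),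
        ExtractionLaws (cr F θ hP g₀ os).l₀ (cr F θ hP g₀ os).T (cr F θ hP g₀ os).A (cr F θ hP g₀ os).Bad X Badx q ∧
        ExtractionLaws (cr F θ hP g₀ os).l₀ (cr F θ hP g₀ os).T (cr F θ hP g₀ os).B (cr F θ hP g₀ os).Bad X' Badx' q' ∧
        (∀ (K : ℕ) (t : ℝ), |t| ≤ (cr F θ hP g₀ os).l₀ → ∀ τ, 0 ≤ (cr F θ hP g₀ os).A K t τ) ∧
        (∀ (K : ℕ) (t : ℝ), |t| ≤ (cr F θ hP g₀ os).l₀ → ∀ τ, 0 ≤ (cr F θ hP g₀ os).B K t τ) ∧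
        (∀ K, ∑ x ∈ X K, q K x ≤ (cr F θ hP g₀ os).W K) ∧ (∀ K, ∑ x ∈ X' K, q' K x ≤ (cr F θ hP g₀ os).W K) ∧
        (∀ K, (cr F θ hP g₀ os).W K < 1) ∧ Summable (cr F θ hP g₀ os).W) :
    S_N20 (SRec₁₁ cr) :=
  s_N20_keyed₁₁_of_extractionLaws cr (SRec₁₁ cr) (fun _ _ _ _ _ h => h) hrows

/-! ## §3 Honesty: the located vacuity of the four antitone stubs at an empty record class -/

/-- **IF THE STAGE-11 RECORD CLASS IS EMPTY, THE FOUR ANTITONE STUBS AT `SRec₁₁ cr` ARE FREE.**  If no admissible Stage-11 tuple satisfies its provisos on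
any family (the NEGATION of K0's body at `N`), `SRec₁₁ cr` pins nothing (§1) and `S_N19`, `S_N20`, `S_N21`, `S_U4` hold with NO estimate (`S_N20` through
p421432 `N20AtSpineCarriers.s_N20_of_empty`).  The monotone `S_N27x` is NOT covered: it is the existence side (and is itself vacuous only through its own
record antecedent). [bookkeeping] -/
theorem k5_sRec₁₁_of_uninhabited (Inputs : InputsPred N)
    (hempty : ∀ (F : T4Family) (θ : Stage11Params F N), θ.Admissible → ¬ θ.Provisos₁₁) :
    S_N19 (SRec₁₁ cr) Inputs ∧ S_N20 (SRec₁₁ cr) ∧ S_N21 (SRec₁₁ cr) ∧ S_U4 (SRec₁₁ cr) :=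
  ⟨fun F D g₀ os S hS => absurd hS (sRec₁₁_empty_of_uninhabited cr hempty F D g₀ os S),
    s_N20_of_empty (SRec₁₁ cr) (sRec₁₁_empty_of_uninhabited cr hempty),
    fun F D g₀ os S hS => absurd hS (sRec₁₁_empty_of_uninhabited cr hempty F D g₀ os S),
    fun F D g₀ os S hS => absurd hS (sRec₁₁_empty_of_uninhabited cr hempty F D g₀ os S)⟩

/-! ## §4 (v1.1, append-only) LAYER A JOINED — node00-def-RR-1's `Node00/RateRecord11.lean` (p455395): the spine OBJECTS of record `Node00.SpineObjects₁₁` and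
the residual `Node00.SpineAssignment₁₁ N` READ AS a reading; the instances restated at the assignment's own fields -/

section LayerA

/-- **THE SPINE CARRIERS OF A SPINE-OBJECTS RECORD** (RR-1's literal, INBOX l.≈12494): field for field, the structure-carried `DecidableEq` handed to
`SpineCarriers.dec` (no instance). [bookkeeping] -/
def spineOfObjects₁₁ (s : Node00.SpineObjects₁₁) : SpineCarriers :=
  { ι := s.ι, dec := s.dec, l₀ := s.l₀, vol := s.vol, K₀ := s.K₀, T := s.T, A := s.A, B := s.B, shA := s.shA, shB := s.shB, Bad := s.Bad, W := s.W,
    Wsh := s.Wsh, δ := s.δ }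

/-- **THE READING OF A RESIDUAL SPINE ASSIGNMENT** `𝔰 : Node00.SpineAssignment₁₁ N` (RR-1 §6: `(F, θ, g₀, os) ↦ SpineObjects₁₁`, the provisos proof not read):
`(F, θ, hP, g₀, os) ↦ spineOfObjects₁₁ (𝔰 F θ g₀ os)`.  `SRec₁₁ (readingOfAssignment₁₁ 𝔰)` is layer A's «`SRec₁₁ 𝔰`». [bookkeeping] -/
def readingOfAssignment₁₁ (𝔰 : Node00.SpineAssignment₁₁ N) : SpineReading₁₁ N :=
  fun F θ _ g₀ os => spineOfObjects₁₁ (𝔰 F θ g₀ os)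

variable (𝔰 : Node00.SpineAssignment₁₁ N)

/-- Unfolding at an assignment (`Iff.rfl`). [bookkeeping] -/
theorem sRec₁₁_assignment_iff {F : T4Family} (D : Datum F N) (g₀ : ℕ → ℝ) (os : List (ULoop F)) (S : SpineCarriers) :
    SRec₁₁ (readingOfAssignment₁₁ 𝔰) F D g₀ os S ↔
      ∃ (θ : Stage11Params F N) (hP : θ.Provisos₁₁), θ.Admissible ∧ D = datumOfRecord₁₁ F N θ hP ∧ S = spineOfObjects₁₁ (𝔰 F θ g₀ os) :=
  Iff.rfl

/-- **N20 AT LAYER A's OBJECTS**: `S_N20 (SRec₁₁ (readingOfAssignment₁₁ 𝔰))` ⟺ «for every admissible Stage-11 θ with provisos, every `g₀`, `os`: NE7b's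
`RelWeightBound` at the FIELDS `l₀, T, A, B, Bad, W` of `𝔰 F θ g₀ os`» (§2 `s_N20_sRec₁₁_iff`, fields by `rfl`). [bookkeeping] -/
theorem s_N20_sRec₁₁_assignment_iff :
    S_N20 (SRec₁₁ (readingOfAssignment₁₁ 𝔰)) ↔ ∀ (F : T4Family) (θ : Stage11Params F N) (_ : θ.Provisos₁₁), θ.Admissible →
      ∀ (g₀ : ℕ → ℝ) (os : List (ULoop F)),
        RelWeightBound (𝔰 F θ g₀ os).l₀ (𝔰 F θ g₀ os).T (𝔰 F θ g₀ os).A (𝔰 F θ g₀ os).B (𝔰 F θ g₀ os).Bad (𝔰 F θ g₀ os).W :=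
  s_N20_sRec₁₁_iff (readingOfAssignment₁₁ 𝔰)

/-- **N21 AT LAYER A's OBJECTS** (fields `l₀, T, A, B, shA, shB, Wsh`). [bookkeeping] -/
theorem s_N21_sRec₁₁_assignment_iff :
    S_N21 (SRec₁₁ (readingOfAssignment₁₁ 𝔰)) ↔ ∀ (F : T4Family) (θ : Stage11Params F N) (_ : θ.Provisos₁₁), θ.Admissible →
      ∀ (g₀ : ℕ → ℝ) (os : List (ULoop F)),
        ShellWeightBound (𝔰 F θ g₀ os).l₀ (𝔰 F θ g₀ os).T (𝔰 F θ g₀ os).A (𝔰 F θ g₀ os).B (𝔰 F θ g₀ os).shA (𝔰 F θ g₀ os).shB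
          (𝔰 F θ g₀ os).Wsh :=
  s_N21_sRec₁₁_iff (readingOfAssignment₁₁ 𝔰)

/-- **N19 AT LAYER A's OBJECTS** (the cores `A − shA`, `B − shB`, the bad sets, `vol`, `δ`; `DecidableEq` = the record's `dec`). [bookkeeping] -/
theorem s_N19_sRec₁₁_assignment_iff (Inputs : InputsPred N) :
    S_N19 (SRec₁₁ (readingOfAssignment₁₁ 𝔰)) Inputs ↔ ∀ (F : T4Family) (θ : Stage11Params F N) (hP : θ.Provisos₁₁), θ.Admissible →
      ∀ (g₀ : ℕ → ℝ) (os : List (ULoop F)), Inputs F (datumOfRecord₁₁ F N θ hP) g₀ os → letI := (𝔰 F θ g₀ os).dec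
        NE7.Core (𝔰 F θ g₀ os).l₀ (𝔰 F θ g₀ os).vol (𝔰 F θ g₀ os).T (𝔰 F θ g₀ os).Bad
          (fun K t τ => (𝔰 F θ g₀ os).A K t τ - (𝔰 F θ g₀ os).shA K t τ)
          (fun K t τ => (𝔰 F θ g₀ os).B K t τ - (𝔰 F θ g₀ os).shB K t τ) (𝔰 F θ g₀ os).δ :=
  s_N19_sRec₁₁_iff (readingOfAssignment₁₁ 𝔰) Inputs

/-- **U4′ AT LAYER A's OBJECTS** (fields `W, Wsh, δ`). [bookkeeping] -/
theorem s_U4_sRec₁₁_assignment_iff :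
    S_U4 (SRec₁₁ (readingOfAssignment₁₁ 𝔰)) ↔ ∀ (F : T4Family) (θ : Stage11Params F N) (_ : θ.Provisos₁₁), θ.Admissible →
      ∀ (g₀ : ℕ → ℝ) (os : List (ULoop F)), (∀ K, (𝔰 F θ g₀ os).W K + (𝔰 F θ g₀ os).Wsh K < 1) ∧ Summable (𝔰 F θ g₀ os).δ :=
  s_U4_sRec₁₁_iff (readingOfAssignment₁₁ 𝔰)

end LayerA

/-! ## §5 (v1.1, append-only) THE CANONICAL KEY JOINED — node00-def-RR-2's `Node00/Record11DatumKey.lean`: a reading READ THROUGH `Node00.canon₁₁` pins ONE bundle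
per datum of record (`Node00.IsDatumOfRecord₁₁C.params`), so spine and rate carriers keyed independently are read AT THE SAME parameter -/

section Canon

/-- **THE CANONICALISED READING**: `cr` read at the canonical Stage-11 parameter of the datum `datumOfRecord₁₁ F N θ hP` (RR-2's `Node00.canon₁₁`, choice; off the
datum-of-record class it reads `cr` itself). [bookkeeping] -/
noncomputable def canonReading₁₁ (cr : SpineReading₁₁ N) : SpineReading₁₁ N :=
  fun F θ hP => Node00.canon₁₁ F N (cr F) θ hP

/-- **THE DATUM-KEYED FACE**: keyed through the canonical reading, `SRec₁₁` pins at `(F, D, g₀, os)` exactly the bundle `cr` reads at the CANONICAL parameter of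
`D` — RR-2's `Node00.exists_keyed_canon₁₁_iff` at `Φ x := (S = x g₀ os)`. [bookkeeping] -/
theorem sRec₁₁_canon_iff {F : T4Family} (D : Datum F N) (g₀ : ℕ → ℝ) (os : List (ULoop F)) (S : SpineCarriers) :
    SRec₁₁ (canonReading₁₁ cr) F D g₀ os S ↔ ∃ h : Node00.IsDatumOfRecord₁₁C F N D, S = cr F h.params h.provisos g₀ os :=
  Node00.exists_keyed_canon₁₁_iff (f := cr F) (fun x => S = x g₀ os)

/-- **ONE BUNDLE PER DATUM**: through the canonical reading two pinned bundles at the same `(F, D, g₀, os)` coincide (proof irrelevance of the key). [bookkeeping] -/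
theorem sRec₁₁_canon_unique {F : T4Family} {D : Datum F N} {g₀ : ℕ → ℝ} {os : List (ULoop F)} {S S' : SpineCarriers}
    (h : SRec₁₁ (canonReading₁₁ cr) F D g₀ os S) (h' : SRec₁₁ (canonReading₁₁ cr) F D g₀ os S') : S = S' := by
  obtain ⟨k, rfl⟩ := (sRec₁₁_canon_iff cr D g₀ os S).mp h
  obtain ⟨k', rfl⟩ := (sRec₁₁_canon_iff cr D g₀ os S').mp h'
  rfl

/-- **N20 THROUGH THE CANONICAL KEY**: `S_N20 (SRec₁₁ (canonReading₁₁ cr))` ⟺ «at every datum of record, NE7b's `RelWeightBound` at the bundle `cr` reads at the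
datum's CANONICAL parameter, for every `g₀`, `os`». [bookkeeping] -/
theorem s_N20_sRec₁₁_canon_iff :
    S_N20 (SRec₁₁ (canonReading₁₁ cr)) ↔ ∀ (F : T4Family) (D : Datum F N) (h : Node00.IsDatumOfRecord₁₁C F N D) (g₀ : ℕ → ℝ) (os : List (ULoop F)),
      RelWeightBound (cr F h.params h.provisos g₀ os).l₀ (cr F h.params h.provisos g₀ os).T (cr F h.params h.provisos g₀ os).A
        (cr F h.params h.provisos g₀ os).B (cr F h.params h.provisos g₀ os).Bad (cr F h.params h.provisos g₀ os).W := by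
  constructor
  · intro hS F D h g₀ os
    exact hS F D g₀ os _ ((sRec₁₁_canon_iff cr D g₀ os _).mpr ⟨h, rfl⟩)
  · intro hS F D g₀ os S hmem
    obtain ⟨h, rfl⟩ := (sRec₁₁_canon_iff cr D g₀ os S).mp hmem
    exact hS F D h g₀ os

/-- **THE θ-FORM IMPLIES THE CANONICAL FORM**: NE7b at `cr`'s reading of EVERY admissible tuple with provisos (`S_N20 (SRec₁₁ cr)`) gives it at the canonical
parameters (`S_N20 (SRec₁₁ (canonReading₁₁ cr))`) — the canonical reading's image lies in `cr`'s (§1 image re-key, p450743 `s_N20_of_image`). [bookkeeping] -/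
theorem s_N20_sRec₁₁_canon_of_sRec₁₁ (h : S_N20 (SRec₁₁ cr)) : S_N20 (SRec₁₁ (canonReading₁₁ cr)) := by
  rw [s_N20_sRec₁₁_canon_iff]
  intro F D hD g₀ os
  exact (s_N20_sRec₁₁_iff cr).mp h F hD.params hD.provisos hD.admissible g₀ os

end Canon

end YMDAG.UVSplit
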